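import Literature.Analysis.Calculus.Sard
import Literature.Topology.FourManifolds.KnotFraming
import Mathlib.MeasureTheory.Constructions.Pi
import Mathlib.MeasureTheory.Measure.Haar.InnerProductSpace
import HarnessLib

/-!
# Regular values of circle-valued maps, from Sard's theorem

Topic `Literature/Topology/FourManifolds`; fact seat
`provefact-Literature.Topology.FourManifolds.Knot.sliceGenus_eq_zero_iff`, glue step G1 of the
transversality construction of Seifert surfaces (Juhász, *Differential and Low-Dimensional
Topology* (2023), proof of Prop. 4.10: "We can perturb `f_α` such that it is smooth, and such
that `1 ∈ S¹` is a regular value"; `SeifertCircleMap.lean` provides the smooth circle-valued map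
`θ` of the knot complement). Everything here is **proved**, over the named fact
`Literature.Analysis.Calculus.sard` (Sard 1942; Milnor, *Topology from the Differentiable
Viewpoint* (1965), §3).

Let `M` be a second-countable `C^∞` manifold modelled on `ℝᵐ` and `θ : M → 𝕊¹` a `C^∞` map
(Mathlib's `𝕊¹ ⊆ ℝ²` with its manifold structure `𝓡 1`). A point `x` is *critical* for `θ`
when `mfderiv θ x = 0` (for a `1`-dimensional target this is the same as "`dθ_x` is not
surjective", `eq_zero_of_not_surjective`).

* `Literature.Topology.FourManifolds.volume_setOf_circlePt_mem_criticalValues_eq_zero`: the set of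
  parameters `t ∈ ℝ` for which `circlePt t = (cos 2πt, sin 2πt)` is a critical value of `θ` is
  Lebesgue-null. Proof (Milnor 1965, §2: "Sard's theorem applies to maps of manifolds by using
  coordinate charts"): cover `M` by the sources of countably many charts `φ`
  (second countability); on `φ(source) ∩ {θ ≠ pole}` the real function
  `h = ang ∘ θ ∘ φ⁻¹`, for either of the two angle functions `angA`, `angB` of
  `TorusCoordinates.lean` (smooth off one point, inverting `circlePt` on an interval of length
  `1`), is smooth and has a critical point wherever `θ` has one (chain rule); by Sard's theorem
  (`m`, `n = 1`) its critical values are null; a critical parameter `t` differs from such a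
  critical value by an integer, and countable unions and integer translates of null sets are
  null.
* `Literature.Topology.FourManifolds.exists_circlePt_isRegularValue_and_antipode`: hence there is
  `t` such that both `circlePt t` and its antipode `circlePt (t + 1/2) = -circlePt t`
  (`coe_circlePt_add_half`) are regular values of `θ` — the two regular values used to close up
  the level surface of `θ` through the knot.

## References

* J. Milnor, *Topology from the Differentiable Viewpoint* (1965), §2 (regular values for maps of
  manifolds via charts), §3 (Sard, Brown). [MilnorTDV1965]
* A. Juhász, *Differential and Low-Dimensional Topology* (2023), proof of Prop. 4.10.
  [Juhasz2023]
-/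

open scoped Manifold ContDiff Topology
open Function Set MeasureTheory Literature.Analysis.Calculus

noncomputable section

namespace Literature.Topology.FourManifolds

universe u

/-- Local notation: `𝔼 n` is the model Euclidean space `EuclideanSpace ℝ (Fin n)`. -/
local notation "𝔼 " n:arg => EuclideanSpace ℝ (Fin n)

/-- Local notation: `𝕊 n` is the unit sphere in `EuclideanSpace ℝ (Fin (n + 1))`. -/
local notation "𝕊 " n:arg => (Metric.sphere (0 : EuclideanSpace ℝ (Fin (n + 1))) 1)

/-! ### Linear algebra and measure-theoretic preliminaries -/

/-- A continuous linear map into a line (a real vector space of dimension `1`, such as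
`EuclideanSpace ℝ (Fin 1)` or a tangent space of `𝕊¹`) which is not surjective is zero.
[folklore] -/
theorem eq_zero_of_not_surjective {E F : Type*} [TopologicalSpace E] [AddCommGroup E]
    [Module ℝ E] [TopologicalSpace F] [AddCommGroup F] [Module ℝ F] [FiniteDimensional ℝ F]
    (hF : Module.finrank ℝ F = 1) (L : E →L[ℝ] F) (h : ¬ Surjective L) : L = 0 := by
  by_contra hL
  apply h
  have hr : LinearMap.range (L : E →ₗ[ℝ] F) = ⊤ := by
    apply Submodule.eq_top_of_finrank_eq
    rw [hF]
    have h1 : Module.finrank ℝ (LinearMap.range (L : E →ₗ[ℝ] F)) ≤ 1 := by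
      simpa [hF] using Submodule.finrank_le (LinearMap.range (L : E →ₗ[ℝ] F))
    have h2 : Module.finrank ℝ (LinearMap.range (L : E →ₗ[ℝ] F)) ≠ 0 := by
      rw [Ne, Submodule.finrank_eq_zero, LinearMap.range_eq_bot]
      exact fun h0 => hL (ContinuousLinearMap.coe_injective h0)
    omega
  exact LinearMap.range_eq_top.mp hr

/-- The tangent spaces of the circle `𝕊¹` are lines. [folklore] -/
theorem finrank_tangentSpace_sphere_one (y : 𝕊 1) :
    Module.finrank ℝ (TangentSpace (𝓡 1) y) = 1 :=
  finrank_euclideanSpace_fin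

/-! ### Antipodes on the circle -/

/-- `circlePt (t + 1/2) = -circlePt t` in `ℝ²`. [folklore] -/
theorem coe_circlePt_add_half (t : ℝ) :
    ((circlePt (t + 1 / 2) : 𝕊 1) : 𝔼 2) = -((circlePt t : 𝕊 1) : 𝔼 2) := by
  ext i
  fin_cases i
  · simp only [circlePt_apply_zero, Fin.zero_eta, PiLp.neg_apply]
    rw [show 2 * Real.pi * (t + 1 / 2) = 2 * Real.pi * t + Real.pi by ring, Real.cos_add_pi]
  · simp only [circlePt_apply_one, Fin.mk_one, PiLp.neg_apply]
    rw [show 2 * Real.pi * (t + 1 / 2) = 2 * Real.pi * t + Real.pi by ring, Real.sin_add_pi]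

/-! ### Sard's theorem for circle-valued maps, in charts -/

section Charts

variable {m : ℕ} {M : Type u} [TopologicalSpace M] [ChartedSpace (𝔼 m) M]
  [IsManifold (𝓡 m) ∞ M] {θ : M → 𝕊 1}

/-- **One chart, one angle function.** Let `θ : M → 𝕊¹` be `C^∞`, `x₀ ∈ M`, and `ang` a real
function on `𝕊¹`, `C^∞` off the point `circlePt p₀` and inverting `circlePt` on
`(p₀, p₀ + 1)`. Then the set of `t` such that `circlePt t ≠ circlePt p₀` is a critical value of
`θ` attained at a critical point in the source of the chart at `x₀` is Lebesgue-null: such `t`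
is an integer translate of a critical value of the smooth real function
`ang ∘ θ ∘ (chart)⁻¹` on an open subset of `ℝᵐ` (Sard, `n = 1`). Milnor (1965), §2–§3.
[cite: MilnorTDV1965, §2 and §3 (Theorem of Sard)] -/
theorem volume_setOf_circlePt_criticalValue_chart_eq_zero (hS : sard)
    (hθ : ContMDiff (𝓡 m) (𝓡 1) ∞ θ) (x₀ : M) (ang : (𝕊 1) → ℝ) (p₀ : ℝ)
    (hsm : ∀ u : 𝕊 1, u ≠ circlePt p₀ → ContMDiffAt (𝓡 1) 𝓘(ℝ, ℝ) ∞ ang u)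
    (hinv : ∀ s ∈ Ioo p₀ (p₀ + 1), ang (circlePt s) = s) :
    volume {t : ℝ | ∃ x ∈ (extChartAt (𝓡 m) x₀).source, θ x ≠ circlePt p₀ ∧
      θ x = circlePt t ∧ mfderiv (𝓡 m) (𝓡 1) θ x = 0} = 0 := by
  set φ := extChartAt (𝓡 m) x₀ with hφ
  set U : Set M := φ.source ∩ θ ⁻¹' {u | u ≠ circlePt p₀} with hU
  have hUo : IsOpen U :=
    (isOpen_extChartAt_source x₀).inter (isOpen_ne.preimage hθ.continuous)
  set V : Set (𝔼 m) := φ.target ∩ φ.symm ⁻¹' U with hV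
  have hVo : IsOpen V :=
    (continuousOn_extChartAt_symm x₀).isOpen_inter_preimage (isOpen_extChartAt_target x₀) hUo
  set h : (𝔼 m) → ℝ := fun z => ang (θ (φ.symm z)) with hh
  -- `ℝ` as `ℝ¹`: the linear embedding `toE1 r = (r)` and the coordinate `e1 p = p 0`
  set toE1 : ℝ →L[ℝ] 𝔼 1 := (EuclideanSpace.equiv (Fin 1) ℝ).symm.toContinuousLinearMap.comp
    (ContinuousLinearMap.pi fun _ : Fin 1 => ContinuousLinearMap.id ℝ ℝ) with htoE1
  have toE1_apply_zero : ∀ r : ℝ, toE1 r 0 = r := fun r => rfl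
  set e1 : (𝔼 1) ≃ᵐ ℝ :=
    (MeasurableEquiv.toLp 2 (Fin 1 → ℝ)).symm.trans (MeasurableEquiv.funUnique (Fin 1) ℝ) with he1
  have e1_apply : ∀ p : 𝔼 1, e1 p = p 0 := fun p => rfl
  have he1m : MeasurePreserving e1 volume volume :=
    (EuclideanSpace.volume_preserving_symm_measurableEquiv_toLp (Fin 1)).trans
      (volume_preserving_funUnique (Fin 1) ℝ)
  have volume_image_e1_eq_zero : ∀ {N : Set (𝔼 1)}, volume N = 0 → volume (e1 '' N) = 0 := by
    intro N hN
    rw [MeasurableEquiv.image_eq_preimage_symm, he1m.symm.measure_preimage_equiv]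
    exact hN
  set g : (𝔼 m) → 𝔼 1 := fun z => toE1 (h z) with hg
  -- smoothness of `h` and `g` on `V`
  have hhs : ContMDiffOn 𝓘(ℝ, 𝔼 m) 𝓘(ℝ, ℝ) ∞ h V := by
    intro z hz
    have h1 : ContMDiffWithinAt 𝓘(ℝ, 𝔼 m) (𝓡 m) ∞ φ.symm V z :=
      (contMDiffOn_extChartAt_symm x₀ z hz.1).mono inter_subset_left
    have h2 : ContMDiffAt (𝓡 m) 𝓘(ℝ, ℝ) ∞ (ang ∘ θ) (φ.symm z) :=
      (hsm _ hz.2.2).comp (φ.symm z) (hθ (φ.symm z))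
    exact h2.comp_contMDiffWithinAt z h1
  have hgs : ContDiffOn ℝ ∞ g V :=
    toE1.contDiff.comp_contDiffOn (contMDiffOn_iff_contDiffOn.mp hhs)
  -- a critical point of `θ` in `U` gives a critical point of `g`
  have hcrit : ∀ z ∈ V, mfderiv (𝓡 m) (𝓡 1) θ (φ.symm z) = 0 →
      ¬ Surjective (fderiv ℝ g z) := by
    intro z hz h0 hsurj
    have hz1 : z ∈ φ.target := hz.1
    have hθd : MDifferentiableAt (𝓡 m) (𝓡 1) θ (φ.symm z) :=
      (hθ (φ.symm z)).mdifferentiableAt (by simp)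
    have hangd : MDifferentiableAt (𝓡 1) 𝓘(ℝ, ℝ) ang (θ (φ.symm z)) :=
      (hsm _ hz.2.2).mdifferentiableAt (by simp)
    have hsymm : MDifferentiableAt 𝓘(ℝ, 𝔼 m) (𝓡 m) φ.symm z := by
      have hw := mdifferentiableWithinAt_extChartAt_symm hz1
      rw [ModelWithCorners.Boundaryless.range_eq_univ] at hw
      exact hw.mdifferentiableAt Filter.univ_mem
    have hcomp1 : mfderiv (𝓡 m) 𝓘(ℝ, ℝ) (ang ∘ θ) (φ.symm z) = 0 := by
      rw [mfderiv_comp (φ.symm z) hangd hθd, h0]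
      exact ContinuousLinearMap.comp_zero _
    have hd1 : MDifferentiableAt (𝓡 m) 𝓘(ℝ, ℝ) (ang ∘ θ) (φ.symm z) := hangd.comp _ hθd
    have hcomp2 : mfderiv 𝓘(ℝ, 𝔼 m) 𝓘(ℝ, ℝ) h z = 0 := by
      have : h = (ang ∘ θ) ∘ φ.symm := rfl
      rw [this, mfderiv_comp z hd1 hsymm, hcomp1]
      exact ContinuousLinearMap.zero_comp _
    have hdh : MDifferentiableAt 𝓘(ℝ, 𝔼 m) 𝓘(ℝ, ℝ) h z := hd1.comp z hsymm
    have hF : HasFDerivAt h (0 : (𝔼 m) →L[ℝ] ℝ) z := by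
      have hmf := hdh.hasMFDerivAt
      rw [hcomp2] at hmf
      exact hasMFDerivAt_iff_hasFDerivAt.mp hmf
    have hG : HasFDerivAt g (toE1.comp (0 : (𝔼 m) →L[ℝ] ℝ)) z := toE1.hasFDerivAt.comp z hF
    rw [ContinuousLinearMap.comp_zero] at hG
    rw [hG.fderiv] at hsurj
    obtain ⟨v, hv⟩ := hsurj (toE1 1)
    have := congrArg (fun p : 𝔼 1 => p 0) hv
    rw [toE1_apply_zero] at this
    simp at this
  -- Sard
  have hnull : volume (g '' {z ∈ V | ¬ Surjective (fderiv ℝ g z)}) = 0 := hS g V hVo hgs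
  have hnull' : volume (e1 '' (g '' {z ∈ V | ¬ Surjective (fderiv ℝ g z)})) = 0 :=
    volume_image_e1_eq_zero hnull
  -- the critical parameters are integer translates of critical values of `g`
  have hsub : {t : ℝ | ∃ x ∈ (extChartAt (𝓡 m) x₀).source, θ x ≠ circlePt p₀ ∧
      θ x = circlePt t ∧ mfderiv (𝓡 m) (𝓡 1) θ x = 0} ⊆
      ⋃ k : ℤ, (fun t : ℝ => t + (-(k : ℝ))) ⁻¹'
        (e1 '' (g '' {z ∈ V | ¬ Surjective (fderiv ℝ g z)})) := by
    rintro t ⟨x, hx, hne, hxt, h0⟩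
    -- reduce `t` modulo `ℤ` into `(p₀, p₀ + 1)`
    set k : ℤ := ⌊t - p₀⌋ with hk
    have hk1 : (k : ℝ) ≤ t - p₀ := Int.floor_le _
    have hk2 : t - p₀ < k + 1 := Int.lt_floor_add_one _
    set s : ℝ := t + (-(k : ℝ)) with hs
    have hst : circlePt s = circlePt t := by
      have := circlePt_add_int t (-k)
      rwa [Int.cast_neg] at this
    have hs_ne : s ≠ p₀ := by
      intro hsp
      apply hne
      rw [hxt, ← hst, hsp]
    have hsI : s ∈ Ioo p₀ (p₀ + 1) := by
      refine ⟨lt_of_le_of_ne (by rw [hs]; linarith) (Ne.symm hs_ne), by rw [hs]; linarith⟩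
    -- `φ x` is a critical point of `g` with `e1 (g (φ x)) = s`
    have hxV : φ x ∈ V := by
      refine ⟨φ.map_source hx, ?_⟩
      show φ.symm (φ x) ∈ U
      rw [φ.left_inv hx]
      exact ⟨hx, hne⟩
    refine mem_iUnion.mpr ⟨k, ?_⟩
    show s ∈ e1 '' (g '' {z ∈ V | ¬ Surjective (fderiv ℝ g z)})
    refine ⟨g (φ x), ⟨φ x, ⟨hxV, hcrit _ hxV (by rw [φ.left_inv hx]; exact h0)⟩, rfl⟩, ?_⟩
    rw [e1_apply, hg]
    simp only [toE1_apply_zero]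
    rw [hh]
    simp only [φ.left_inv hx, hxt, ← hst, hinv s hsI]
  refine measure_mono_null hsub ?_
  rw [measure_iUnion_null_iff]
  intro k
  rw [measure_preimage_add_right]
  exact hnull'

/-- **The critical values of a smooth circle-valued map are null** (Sard's theorem for maps into
`𝕊¹`; Milnor (1965), §2: Sard's theorem for maps of manifolds follows from the Euclidean case by
using coordinate charts, the manifold being a countable union of chart domains). For a `C^∞`
map `θ : M → 𝕊¹` on a second-countable `C^∞` `m`-manifold, the set of `t ∈ ℝ` such that
`circlePt t` is the image of a critical point (`mfderiv θ x = 0`) has Lebesgue measure `0`;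
granted the named fact `sard`. [cite: MilnorTDV1965, §2 and §3 (Theorem of Sard)] -/
theorem volume_setOf_circlePt_mem_criticalValues_eq_zero [SecondCountableTopology M]
    (hS : sard) (hθ : ContMDiff (𝓡 m) (𝓡 1) ∞ θ) :
    volume {t : ℝ | ∃ x, θ x = circlePt t ∧ mfderiv (𝓡 m) (𝓡 1) θ x = 0} = 0 := by
  obtain ⟨s, hsc, hcover⟩ := TopologicalSpace.countable_cover_nhds
    (f := fun x : M => (extChartAt (𝓡 m) x).source) fun x => extChartAt_source_mem_nhds x
  -- the two angle functions
  have hA := fun x₀ : M => volume_setOf_circlePt_criticalValue_chart_eq_zero hS hθ x₀ angA 0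
    (fun u hu => contMDiffAt_angA hu) (fun r hr => angA_circlePt (by simpa using hr))
  have hB := fun x₀ : M => volume_setOf_circlePt_criticalValue_chart_eq_zero hS hθ x₀ angB (1 / 2)
    (fun u hu => contMDiffAt_angB hu) (fun r hr => angB_circlePt (by norm_num at hr ⊢; exact hr))
  have hsub : {t : ℝ | ∃ x, θ x = circlePt t ∧ mfderiv (𝓡 m) (𝓡 1) θ x = 0} ⊆
      ⋃ x₀ ∈ s, ({t : ℝ | ∃ x ∈ (extChartAt (𝓡 m) x₀).source, θ x ≠ circlePt 0 ∧
          θ x = circlePt t ∧ mfderiv (𝓡 m) (𝓡 1) θ x = 0} ∪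
        {t : ℝ | ∃ x ∈ (extChartAt (𝓡 m) x₀).source, θ x ≠ circlePt (1 / 2) ∧
          θ x = circlePt t ∧ mfderiv (𝓡 m) (𝓡 1) θ x = 0}) := by
    rintro t ⟨x, hxt, h0⟩
    have hx : x ∈ ⋃ x₀ ∈ s, (extChartAt (𝓡 m) x₀).source := by rw [hcover]; trivial
    obtain ⟨x₀, hx₀, hx⟩ := mem_iUnion₂.mp hx
    refine mem_iUnion₂.mpr ⟨x₀, hx₀, ?_⟩
    by_cases hθA : θ x = ptA
    · right
      refine ⟨x, hx, ?_, hxt, h0⟩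
      rw [hθA]
      exact ptA_ne_ptB
    · left
      exact ⟨x, hx, hθA, hxt, h0⟩
  refine measure_mono_null hsub ((measure_biUnion_null_iff hsc).mpr fun x₀ _ => ?_)
  exact measure_union_null (hA x₀) (hB x₀)

/-- **Regular values of a circle-valued map exist, together with their antipodes**: for a `C^∞`
map `θ : M → 𝕊¹` on a second-countable `C^∞` manifold there is `t` such that `θ` has no
critical point over `circlePt t` nor over `circlePt (t + 1/2) = -circlePt t` (Brown's corollary
of Sard's theorem, Milnor (1965), §3, applied to the null set of critical parameters and its
translate by `1/2`); granted `sard`. [cite: MilnorTDV1965, §3, Corollary (Brown) p. 17] -/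
theorem exists_circlePt_isRegularValue_and_antipode [SecondCountableTopology M] (hS : sard)
    (hθ : ContMDiff (𝓡 m) (𝓡 1) ∞ θ) :
    ∃ t : ℝ, (∀ x, θ x = circlePt t → mfderiv (𝓡 m) (𝓡 1) θ x ≠ 0) ∧
      (∀ x, θ x = circlePt (t + 1 / 2) → mfderiv (𝓡 m) (𝓡 1) θ x ≠ 0) := by
  set N := {t : ℝ | ∃ x, θ x = circlePt t ∧ mfderiv (𝓡 m) (𝓡 1) θ x = 0} with hN
  have hN0 : volume N = 0 := volume_setOf_circlePt_mem_criticalValues_eq_zero hS hθ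
  have hN1 : volume ((fun t : ℝ => t + 1 / 2) ⁻¹' N) = 0 := by
    rw [measure_preimage_add_right]; exact hN0
  have hbad : volume (N ∪ (fun t : ℝ => t + 1 / 2) ⁻¹' N) = 0 := measure_union_null hN0 hN1
  obtain ⟨t, ht⟩ : (N ∪ (fun t : ℝ => t + 1 / 2) ⁻¹' N)ᶜ.Nonempty := by
    by_contra hcon
    rw [not_nonempty_iff_eq_empty, compl_empty_iff] at hcon
    rw [hcon, Real.volume_univ] at hbad
    exact ENNReal.top_ne_zero hbad
  rw [mem_compl_iff, mem_union, not_or] at ht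
  refine ⟨t, fun x hx h0 => ht.1 ⟨x, hx, h0⟩, fun x hx h0 => ht.2 ⟨x, hx, h0⟩⟩

/-- The same, with surjectivity of the differential as regularity (for a `1`-dimensional target
`mfderiv θ x ≠ 0 ↔ dθ_x` onto, `eq_zero_of_not_surjective`). [cite: MilnorTDV1965, §3, Corollary (Brown) p. 17] -/
theorem exists_circlePt_surjective_mfderiv_and_antipode [SecondCountableTopology M] (hS : sard)
    (hθ : ContMDiff (𝓡 m) (𝓡 1) ∞ θ) :
    ∃ t : ℝ, (∀ x, θ x = circlePt t → Surjective (mfderiv (𝓡 m) (𝓡 1) θ x)) ∧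
      (∀ x, θ x = circlePt (t + 1 / 2) → Surjective (mfderiv (𝓡 m) (𝓡 1) θ x)) := by
  obtain ⟨t, h1, h2⟩ := exists_circlePt_isRegularValue_and_antipode hS hθ
  haveI : ∀ y : 𝕊 1, FiniteDimensional ℝ (TangentSpace (𝓡 1) y) := fun _ =>
    inferInstanceAs (FiniteDimensional ℝ (𝔼 1))
  refine ⟨t, fun x hx => ?_, fun x hx => ?_⟩
  · by_contra hs
    exact h1 x hx (eq_zero_of_not_surjective (finrank_tangentSpace_sphere_one (θ x))
      (mfderiv (𝓡 m) (𝓡 1) θ x) hs)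
  · by_contra hs
    exact h2 x hx (eq_zero_of_not_surjective (finrank_tangentSpace_sphere_one (θ x))
      (mfderiv (𝓡 m) (𝓡 1) θ x) hs)

end Charts

end Literature.Topology.FourManifolds
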